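import Literature.Analysis.FluidPDE.SereginZhou2020BesovPairing
import Literature.Analysis.UnboundedOperators.HeatSmoothingDefect
import Mathlib.Analysis.SpecialFunctions.Pow.Integral
import HarnessLib

/-!
# The local weak-`L⁴` / `L³` interpolation of a `Ḃ^{-1}_{∞,∞}`-bounded field on balls

Analysis/FluidPDE proof file (theorems only; no definitions, no named facts) on the way to the
corrected form of Seregin–Zhou 2020, Thm 1.2 (`SereginZhou2020.lean`). It proves the tree's
version of Seregin–Zhou 2020, Lemma 2.3 (the scaled weak-`L⁴` interpolation (2.2)/(2.3),
there deduced from the Ledoux / Hajaiej–Molinet–Ozawa–Wang multiplicative inequality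
`‖u‖_{L^{4,∞}} ≤ c ‖u‖^{1/2}_{Ḃ^{-1}_{∞,∞}} ‖∇u‖^{1/2}_{L²}` and the cut-off Lemma 2.2) together
with the Hölder step of their Lemma 2.4: for a field `f` with heat-flow bound
`‖e^{sΔ}f‖_∞ ≤ M s^{-1/2}` and a weak derivative `g` on the ball `B(x₀, 2r)`,

  `∫_{B(x₀,r)} |f|³ ≤ C · |B(x₀,r)|^{1/4} · M^{3/2} · (‖g‖²_{L²(B(x₀,2r))} + r⁻² ‖f‖²_{L²(B(x₀,2r))})^{3/4}`

(`exists_lintegral_ball_enorm_pow_three_le`), with `C` depending only on `E`.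

## Proof (Ledoux's heat-flow argument, localised)

Let `φ` be a cut-off equal to `1` on `B(x₀,r)` and supported in `B(x₀,2r)` with
`‖Dφ‖ ≤ c₁/r`, `‖D²φ‖ ≤ c₂/r²` (`exists_cutoff`), and `F = φ f`. For `λ > 0` large, with
`t = (4 C₂ M / λ)² ≤ r²`, on `B(x₀, r)` one has `f = F = e^{tΔ}F + (F − e^{tΔ}F)` with
`‖e^{tΔ}F‖ ≤ C₂ M t^{-1/2} = λ/4` (`HeatBesovPairing.norm_heatExtension_cutoff_smul_le`), so
`|{|f| > λ} ∩ B_r| ≤ |{|F − e^{tΔ}F| ≥ λ/2}| ≤ 4λ⁻² ‖F − e^{tΔ}F‖₂² ≤ 4 d t λ⁻² ‖∇F‖₂²`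
(`Literature.Analysis.UnboundedOperators.eLpNorm_smul_sub_heatExtension_smul_le`), which is
`≲ M² λ⁻⁴ ‖∇F‖₂²`; for `λ` small, Chebyshev on `f` itself. The weak-`L⁴` bound is turned into
the `L³` bound by the layer-cake formula on the ball.

## References

* G. Seregin, D. Zhou, J. Math. Sci. 244 (2020) = arXiv:1802.03600, Lemmas 2.1–2.4.
  [`SereginZhou2020`]
* M. Ledoux, Math. Res. Lett. 10 (2003), §1. [`Ledoux2003`]
-/

noncomputable section

open MeasureTheory Set Function Filter Topology Metric InnerProductSpace
open scoped ENNReal NNReal RealInnerProductSpace ContDiff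

namespace Literature.Analysis.FluidPDE

open Literature.Analysis.UnboundedOperators

namespace SereginZhouWeakL4

variable {E : Type*} [NormedAddCommGroup E] [InnerProductSpace ℝ E] [FiniteDimensional ℝ E]
  [MeasurableSpace E] [BorelSpace E]

/-! ### Cut-offs at scale `r` with `‖Dφ‖ ≤ c₁/r`, `‖D²φ‖ ≤ c₂/r²` -/

omit [FiniteDimensional ℝ E] [MeasurableSpace E] [BorelSpace E] in
/-- Derivatives of a rescaled translate: for `φ(y) = φ₁(r⁻¹ (y − x₀))`,
`‖Dⁿφ(y)‖ ≤ r⁻ⁿ ‖Dⁿφ₁(r⁻¹(y − x₀))‖`. [folklore] -/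
theorem norm_iteratedFDeriv_comp_rescale_le {φ₁ : E → ℝ} (hφ₁ : ContDiff ℝ ∞ φ₁) {r : ℝ}
    (hr : 0 < r) (x₀ : E) (n : ℕ) (y : E) :
    ‖iteratedFDeriv ℝ n (fun y => φ₁ (r⁻¹ • (y - x₀))) y‖ ≤
      r⁻¹ ^ n * ‖iteratedFDeriv ℝ n φ₁ (r⁻¹ • (y - x₀))‖ := by
  set L : E →L[ℝ] E := r⁻¹ • ContinuousLinearMap.id ℝ E with hL
  have hLn : ‖L‖ ≤ r⁻¹ := by
    rw [hL]
    refine (norm_smul_le (r⁻¹) (ContinuousLinearMap.id ℝ E)).trans ?_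
    rw [Real.norm_of_nonneg (inv_nonneg.2 hr.le)]
    exact mul_le_of_le_one_right (inv_nonneg.2 hr.le) ContinuousLinearMap.norm_id_le
  have e1 : (fun y => φ₁ (r⁻¹ • (y - x₀))) = fun y => (φ₁ ∘ L) (y - x₀) := by
    funext y; simp [hL]
  rw [e1, iteratedFDeriv_comp_sub n x₀ y,
    L.iteratedFDeriv_comp_right hφ₁ (y - x₀) (by exact_mod_cast le_top)]
  refine (ContinuousMultilinearMap.norm_compContinuousLinearMap_le _ _).trans ?_
  rw [Finset.prod_const, Finset.card_univ, Fintype.card_fin, mul_comm]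
  have hLy : L (y - x₀) = r⁻¹ • (y - x₀) := by simp [hL]
  rw [hLy]
  exact mul_le_mul_of_nonneg_right (pow_le_pow_left₀ (norm_nonneg _) hLn n) (norm_nonneg _)

omit [MeasurableSpace E] [BorelSpace E] in
/-- **Cut-offs at every scale.** There are `c₁, c₂ ≥ 0` (depending only on `E`) such that for
every centre `x₀` and radius `r > 0` there is `φ ∈ C_c^∞(E)` with `0 ≤ φ ≤ 1`, `φ = 1` on
`B̄(x₀, r)`, `tsupport φ ⊆ B(x₀, 2r)`, `‖Dφ‖ ≤ c₁/r` and `‖D²φ‖ ≤ c₂/r²` (rescale a fixed bump).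
[folklore] -/
theorem exists_cutoff :
    ∃ c₁ c₂ : ℝ, 0 ≤ c₁ ∧ 0 ≤ c₂ ∧ ∀ (x₀ : E) (r : ℝ), 0 < r →
      ∃ φ : E → ℝ, ContDiff ℝ ∞ φ ∧ HasCompactSupport φ ∧ tsupport φ ⊆ ball x₀ (2 * r) ∧
        (∀ y ∈ closedBall x₀ r, φ y = 1) ∧ (∀ y, 0 ≤ φ y) ∧ (∀ y, φ y ≤ 1) ∧
        (∀ y, ‖iteratedFDeriv ℝ 1 φ y‖ ≤ c₁ / r) ∧ (∀ y, ‖iteratedFDeriv ℝ 2 φ y‖ ≤ c₂ / r ^ 2) := by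
  let φ₁ : ContDiffBump (0 : E) := ⟨1, 3 / 2, one_pos, by norm_num⟩
  have hφ₁ : ContDiff ℝ ∞ φ₁ := φ₁.contDiff
  have hφ₁c : HasCompactSupport φ₁ := φ₁.hasCompactSupport
  obtain ⟨c₁, hc₁⟩ := ((contDiff_infty.1 hφ₁ 1).continuous_iteratedFDeriv (m := 1)
    le_rfl).bounded_above_of_compact_support (hφ₁c.iteratedFDeriv 1)
  obtain ⟨c₂, hc₂⟩ := ((contDiff_infty.1 hφ₁ 2).continuous_iteratedFDeriv (m := 2)
    le_rfl).bounded_above_of_compact_support (hφ₁c.iteratedFDeriv 2)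
  have hc₁0 : 0 ≤ c₁ := (norm_nonneg _).trans (hc₁ 0)
  have hc₂0 : 0 ≤ c₂ := (norm_nonneg _).trans (hc₂ 0)
  refine ⟨c₁, c₂, hc₁0, hc₂0, fun x₀ r hr => ?_⟩
  set φ : E → ℝ := fun y => φ₁ (r⁻¹ • (y - x₀)) with hφ
  have hA : ContDiff ℝ ∞ (fun y : E => r⁻¹ • (y - x₀)) := (contDiff_id.sub contDiff_const).const_smul _
  have hsupp : tsupport φ ⊆ closedBall x₀ (3 / 2 * r) := by
    refine closure_minimal ?_ isClosed_closedBall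
    intro y hy
    rw [mem_support] at hy
    by_contra hy'
    rw [mem_closedBall, dist_eq_norm, not_le] at hy'
    apply hy
    rw [hφ]; dsimp only
    refine φ₁.zero_of_le_dist ?_
    rw [dist_zero_right, norm_smul, Real.norm_of_nonneg (inv_nonneg.2 hr.le)]
    show (3 / 2 : ℝ) ≤ r⁻¹ * ‖y - x₀‖
    rw [le_inv_mul_iff₀ hr]
    linarith
  refine ⟨φ, hφ₁.comp hA, ?_, ?_, ?_, fun y => φ₁.nonneg, fun y => φ₁.le_one, fun y => ?_, fun y => ?_⟩
  · exact HasCompactSupport.of_support_subset_isCompact (isCompact_closedBall x₀ (3 / 2 * r))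
      (subset_tsupport _ |>.trans hsupp)
  · exact hsupp.trans (closedBall_subset_ball (by linarith))
  · intro y hy
    rw [hφ]; dsimp only
    refine φ₁.one_of_mem_closedBall ?_
    rw [mem_closedBall, dist_zero_right, norm_smul, Real.norm_of_nonneg (inv_nonneg.2 hr.le)]
    rw [mem_closedBall, dist_eq_norm] at hy
    show r⁻¹ * ‖y - x₀‖ ≤ 1
    rw [inv_mul_le_iff₀ hr]
    linarith
  · refine (norm_iteratedFDeriv_comp_rescale_le hφ₁ hr x₀ 1 y).trans ?_
    rw [pow_one, div_eq_inv_mul]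
    exact mul_le_mul_of_nonneg_left (hc₁ _) (inv_nonneg.2 hr.le)
  · refine (norm_iteratedFDeriv_comp_rescale_le hφ₁ hr x₀ 2 y).trans ?_
    rw [div_eq_inv_mul, ← inv_pow]
    exact mul_le_mul_of_nonneg_left (hc₂ _) (by positivity)

/-! ### Layer cake: from a weak-`L⁴` bound on a set of finite measure to `L³` -/

/-- **Optimising the layer-cake integral of a weak-`L⁴` majorant on a set of measure `V`:**
`∫₀^∞ min(V, A t⁻⁴) t² dt ≤ 2 A^{3/4} V^{1/4}` (split at `Λ = (A/V)^{1/4}`). [folklore] -/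
theorem lintegral_Ioi_min_mul_sq_le (V A : ℝ≥0∞) :
    ∫⁻ t in Ioi (0 : ℝ), min V (A * (ENNReal.ofReal t)⁻¹ ^ 4) * ENNReal.ofReal (t ^ 2) ≤
      2 * A ^ (3 / 4 : ℝ) * V ^ (1 / 4 : ℝ) := by
  -- degenerate cases
  by_cases hA0 : A = 0
  · have : ∀ t ∈ Ioi (0 : ℝ), min V (A * (ENNReal.ofReal t)⁻¹ ^ 4) * ENNReal.ofReal (t ^ 2) = 0 := by
      intro t _; simp [hA0]
    rw [setLIntegral_congr_fun measurableSet_Ioi this, lintegral_zero]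
    exact zero_le
  by_cases hV0 : V = 0
  · have : ∀ t ∈ Ioi (0 : ℝ), min V (A * (ENNReal.ofReal t)⁻¹ ^ 4) * ENNReal.ofReal (t ^ 2) = 0 := by
      intro t _; simp [hV0]
    rw [setLIntegral_congr_fun measurableSet_Ioi this, lintegral_zero]
    exact zero_le
  have hV4 : V ^ (1 / 4 : ℝ) ≠ 0 := by simp [ENNReal.rpow_eq_zero_iff, hV0]
  have hA34 : A ^ (3 / 4 : ℝ) ≠ 0 := by
    simp only [Ne, ENNReal.rpow_eq_zero_iff, hA0, false_and, false_or, not_and, not_lt]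
    intro _; norm_num
  by_cases hAtop : A = ⊤
  · rw [hAtop, ENNReal.top_rpow_of_pos (by norm_num), ENNReal.mul_top two_ne_zero,
      ENNReal.top_mul hV4]
    exact le_top
  by_cases hVtop : V = ⊤
  · rw [hVtop, ENNReal.top_rpow_of_pos (by norm_num), ENNReal.mul_top (mul_ne_zero two_ne_zero hA34)]
    exact le_top
  -- main case: `0 < a, v < ∞`
  set a : ℝ := A.toReal with ha
  set v : ℝ := V.toReal with hv
  have ha0 : 0 < a := ENNReal.toReal_pos hA0 hAtop
  have hv0 : 0 < v := ENNReal.toReal_pos hV0 hVtop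
  have hAa : A = ENNReal.ofReal a := (ENNReal.ofReal_toReal hAtop).symm
  have hVv : V = ENNReal.ofReal v := (ENNReal.ofReal_toReal hVtop).symm
  set Λ : ℝ := (a / v) ^ (1 / 4 : ℝ) with hΛ
  have hΛ0 : 0 < Λ := Real.rpow_pos_of_pos (div_pos ha0 hv0) _
  -- the target value
  set X : ℝ := a ^ (3 / 4 : ℝ) * v ^ (1 / 4 : ℝ) with hX
  have hX0 : 0 ≤ X := by positivity
  have hRHS : 2 * A ^ (3 / 4 : ℝ) * V ^ (1 / 4 : ℝ) = ENNReal.ofReal X + ENNReal.ofReal X := by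
    rw [hAa, hVv, ENNReal.ofReal_rpow_of_nonneg ha0.le (by norm_num),
      ENNReal.ofReal_rpow_of_nonneg hv0.le (by norm_num), mul_assoc, ← ENNReal.ofReal_mul (by positivity),
      ← hX, two_mul]
  have hΛ4 : Λ ^ (4 : ℕ) = a / v := by
    rw [hΛ, ← Real.rpow_natCast, ← Real.rpow_mul (div_pos ha0 hv0).le]; norm_num
  have hΛ3 : v * Λ ^ (3 : ℕ) = X := by
    -- `v Λ³ = v Λ⁴ / Λ = a / Λ` and `a / Λ = a (a/v)^{-1/4} = a^{3/4} v^{1/4}`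
    have e1 : Λ ^ (3 : ℕ) = (a / v) ^ (3 / 4 : ℝ) := by
      rw [hΛ, ← Real.rpow_natCast, ← Real.rpow_mul (div_pos ha0 hv0).le]; norm_num
    rw [e1, Real.div_rpow ha0.le hv0.le, hX, mul_div_assoc', mul_comm v, mul_div_assoc]
    congr 1
    rw [div_eq_iff (Real.rpow_pos_of_pos hv0 _).ne', ← Real.rpow_add hv0]
    norm_num
  have hΛ1 : a * Λ⁻¹ = X := by
    have e2 : Λ⁻¹ = a ^ (-(1 / 4) : ℝ) * v ^ (1 / 4 : ℝ) := by
      rw [hΛ, Real.div_rpow ha0.le hv0.le, inv_div, div_eq_mul_inv, ← Real.rpow_neg ha0.le, mul_comm]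
    rw [e2, hX, ← mul_assoc]
    congr 1
    conv_lhs => rw [show a * a ^ (-(1 / 4) : ℝ) = a ^ (1 : ℝ) * a ^ (-(1 / 4) : ℝ) by rw [Real.rpow_one]]
    rw [← Real.rpow_add ha0]
    norm_num
  -- split the integral at `Λ`
  rw [← Ioc_union_Ioi_eq_Ioi hΛ0.le, lintegral_union measurableSet_Ioi Ioc_disjoint_Ioi_same]
  refine (add_le_add ?_ ?_).trans_eq hRHS.symm
  · -- on `(0, Λ]`: bound by `V Λ²`, measure `Λ`
    calc ∫⁻ t in Ioc 0 Λ, min V (A * (ENNReal.ofReal t)⁻¹ ^ 4) * ENNReal.ofReal (t ^ 2)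
        ≤ ∫⁻ _ in Ioc 0 Λ, V * ENNReal.ofReal (Λ ^ 2) := by
          refine setLIntegral_mono' measurableSet_Ioc fun t ht => ?_
          exact mul_le_mul' (min_le_left _ _) (ENNReal.ofReal_le_ofReal
            (pow_le_pow_left₀ ht.1.le ht.2 2))
      _ = ENNReal.ofReal X := by
          rw [setLIntegral_const, Real.volume_Ioc, sub_zero, hVv, ← ENNReal.ofReal_mul hv0.le,
            ← ENNReal.ofReal_mul (by positivity), ← hΛ3]
          ring_nf
  · -- on `(Λ, ∞)`: bound by `A t⁻²`
    calc ∫⁻ t in Ioi Λ, min V (A * (ENNReal.ofReal t)⁻¹ ^ 4) * ENNReal.ofReal (t ^ 2)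
        ≤ ∫⁻ t in Ioi Λ, A * ENNReal.ofReal (t ^ (-2 : ℝ)) := by
          refine setLIntegral_mono' measurableSet_Ioi fun t ht => ?_
          have ht0 : 0 < t := hΛ0.trans ht
          refine (mul_le_mul_left (min_le_right _ _) _).trans_eq ?_
          rw [mul_assoc]
          congr 1
          rw [← ENNReal.ofReal_inv_of_pos ht0, ← ENNReal.ofReal_pow (inv_nonneg.2 ht0.le),
            ← ENNReal.ofReal_mul (by positivity)]
          congr 1
          rw [Real.rpow_neg ht0.le, show (2 : ℝ) = ((2 : ℕ) : ℝ) by norm_num, Real.rpow_natCast]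
          field_simp
      _ = A * ENNReal.ofReal Λ⁻¹ := by
          rw [lintegral_const_mul' _ _ hAtop, lintegral_Ioi_rpow (by norm_num) hΛ0]
          congr 2
          rw [show (-2 : ℝ) + 1 = -1 by norm_num, Real.rpow_neg_one]
          ring
      _ = ENNReal.ofReal X := by
          rw [hAa, ← ENNReal.ofReal_mul ha0.le, hΛ1]

/-! ### Two Chebyshev steps -/

/-- **Chebyshev after a decomposition.** If `f = F` on `s`, `F = u + h` with `‖u‖ ≤ λ/4`
everywhere, then `|{‖f‖ > λ} ∩ s| ≤ (λ/2)⁻² ‖h‖₂²`. [folklore] -/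
theorem volume_inter_lt_norm_le_of_decomposition {f F u h : E → E} {s : Set E} {lam : ℝ}
    (hlam : 0 < lam) (hfF : ∀ y ∈ s, f y = F y) (hFuh : ∀ y, F y = u y + h y)
    (hu : ∀ y, ‖u y‖ ≤ lam / 4) (hh : AEStronglyMeasurable h volume) :
    volume ({y | lam < ‖f y‖} ∩ s) ≤
      (ENNReal.ofReal (lam / 2))⁻¹ ^ (2 : ℝ) * eLpNorm h 2 volume ^ (2 : ℝ) := by
  have hsub : {y | lam < ‖f y‖} ∩ s ⊆ {y | ENNReal.ofReal (lam / 2) ≤ ‖h y‖ₑ} := by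
    rintro y ⟨hy, hys⟩
    rw [mem_setOf_eq] at hy ⊢
    rw [hfF y hys, hFuh y] at hy
    have h1 : ‖u y + h y‖ ≤ ‖u y‖ + ‖h y‖ := norm_add_le _ _
    have h2 : lam / 2 ≤ ‖h y‖ := by linarith [hu y]
    rw [← ofReal_norm]
    exact ENNReal.ofReal_le_ofReal h2
  refine (measure_mono hsub).trans ?_
  have := meas_ge_le_mul_pow_eLpNorm_enorm volume (p := 2) two_ne_zero ENNReal.ofNat_ne_top hh
    (ε := ENNReal.ofReal (lam / 2)) (by simpa using hlam) (fun h => absurd h ENNReal.ofReal_ne_top)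
  simpa using this

/-- **Chebyshev on a set**: `|{‖f‖ > λ} ∩ s| ≤ λ⁻² ‖f‖²_{L²(s)}`. [folklore] -/
theorem volume_inter_lt_norm_le {f : E → E} {s : Set E} (hs : MeasurableSet s) {lam : ℝ}
    (hlam : 0 < lam) (hf : AEStronglyMeasurable f (volume.restrict s)) :
    volume ({y | lam < ‖f y‖} ∩ s) ≤
      (ENNReal.ofReal lam)⁻¹ ^ (2 : ℝ) * eLpNorm f 2 (volume.restrict s) ^ (2 : ℝ) := by
  have hsub : {y | lam < ‖f y‖} ⊆ {y | ENNReal.ofReal lam ≤ ‖f y‖ₑ} := fun y hy => by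
    rw [mem_setOf_eq] at hy ⊢
    rw [← ofReal_norm]
    exact ENNReal.ofReal_le_ofReal hy.le
  rw [← Measure.restrict_apply' hs]
  refine (measure_mono hsub).trans ?_
  have := meas_ge_le_mul_pow_eLpNorm_enorm (volume.restrict s) (p := 2) two_ne_zero
    ENNReal.ofNat_ne_top hf (ε := ENNReal.ofReal lam) (by simpa using hlam)
    (fun h => absurd h ENNReal.ofReal_ne_top)
  simpa using this

/-! ### The `L²` size of the cut-off gradient -/

/-- **The gradient of a cut-off product**, `L²` bound: with `|φ| ≤ 1`, `‖Dφ‖ ≤ c₁/r` and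
`tsupport φ ⊆ B(x₀, 2r)`,
`‖φ g + Dφ ⊗ f‖_{L²(E)} ≤ ‖g‖_{L²(B(x₀,2r))} + (c₁/r) ‖f‖_{L²(B(x₀,2r))}`. [folklore] -/
theorem eLpNorm_cutoff_gradient_le {f : E → E} {g : E → E →L[ℝ] E} {φ : E → ℝ} {x₀ : E}
    {r c₁ : ℝ} (hφ1 : ContDiff ℝ 1 φ)
    (hφsupp : tsupport φ ⊆ ball x₀ (2 * r)) (h0 : ∀ y, |φ y| ≤ 1)
    (h1 : ∀ y, ‖fderiv ℝ φ y‖ ≤ c₁ / r)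
    (hfm : AEStronglyMeasurable f (volume.restrict (ball x₀ (2 * r))))
    (hgm : AEStronglyMeasurable g (volume.restrict (ball x₀ (2 * r)))) :
    eLpNorm (fun y => φ y • g y + (fderiv ℝ φ y).smulRight (f y)) 2 volume ≤
      eLpNorm g 2 (volume.restrict (ball x₀ (2 * r))) +
        ENNReal.ofReal (c₁ / r) * eLpNorm f 2 (volume.restrict (ball x₀ (2 * r))) := by
  set μ := volume.restrict (ball x₀ (2 * r)) with hμ
  -- the gradient vanishes off `tsupport φ ⊆ B(x₀, 2r)`
  have hsupp : support (fun y => φ y • g y + (fderiv ℝ φ y).smulRight (f y)) ⊆ ball x₀ (2 * r) := by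
    intro y hy
    by_contra hy'
    apply hy
    have hφy : y ∉ tsupport φ := fun h => hy' (hφsupp h)
    simp [image_eq_zero_of_notMem_tsupport hφy, fderiv_of_notMem_tsupport ℝ hφy]
  rw [← eLpNorm_restrict_eq_of_support_subset (μ := volume) (p := 2)
    (f := fun y => φ y • g y + (fderiv ℝ φ y).smulRight (f y)) hsupp, ← hμ]
  have hm1 : AEStronglyMeasurable (fun y => φ y • g y) μ :=
    (hφ1.continuous.aestronglyMeasurable).smul hgm
  have hm2 : AEStronglyMeasurable (fun y => (fderiv ℝ φ y).smulRight (f y)) μ :=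
    ContinuousLinearMap.smulRightL ℝ E E |>.continuous₂.comp_aestronglyMeasurable₂
      ((hφ1.continuous_fderiv one_ne_zero).aestronglyMeasurable) hfm
  refine (eLpNorm_add_le hm1 hm2 (by norm_num)).trans (add_le_add ?_ ?_)
  · refine eLpNorm_mono_ae (Eventually.of_forall fun y => ?_)
    rw [norm_smul, Real.norm_eq_abs]
    exact mul_le_of_le_one_left (norm_nonneg _) (h0 y)
  · refine eLpNorm_le_mul_eLpNorm_of_ae_le_mul (Eventually.of_forall fun y => ?_) 2
    rw [ContinuousLinearMap.norm_smulRight_apply]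
    exact mul_le_mul_of_nonneg_right (h1 y) (norm_nonneg _)

/-! ### The local weak-`L⁴` bound and the `L³` bound on balls -/

/-- Rescaling identity `((a/λ)²)^{-1/2} = λ/a` for `0 < a, λ`. [folklore] -/
theorem sq_rpow_neg_half {a lam : ℝ} (ha : 0 < a) (hlam : 0 < lam) :
    ((a / lam) ^ 2) ^ (-(1 / 2 : ℝ)) = lam / a := by
  rw [← Real.rpow_natCast, ← Real.rpow_mul (div_pos ha hlam).le]
  norm_num
  rw [Real.rpow_neg_one, inv_div]

/-! ### Algebraic bookkeeping for the weak-`L⁴` step (kept out of the main proof) -/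

/-- Small-`λ` algebra: `λ⁻² ≤ 16 C₂² M² r⁻² λ⁻⁴` when `0 < λ < 4 C₂ M / r`. [folklore] -/
theorem inv_sq_le_const_mul_inv_pow_four {C₂ M r lam : ℝ} (hr : 0 < r) (hlam : 0 < lam)
    (hcase : lam < 4 * C₂ * M / r) :
    lam⁻¹ ^ 2 ≤ 16 * C₂ ^ 2 * M ^ 2 * r⁻¹ ^ 2 * lam⁻¹ ^ 4 := by
  have h1 : lam ^ 2 ≤ (4 * C₂ * M / r) ^ 2 := pow_le_pow_left₀ hlam.le hcase.le 2
  rw [show lam⁻¹ ^ 2 = lam ^ 2 * lam⁻¹ ^ 4 by field_simp]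
  rw [show 16 * C₂ ^ 2 * M ^ 2 * r⁻¹ ^ 2 * lam⁻¹ ^ 4 = (4 * C₂ * M / r) ^ 2 * lam⁻¹ ^ 4 by
    field_simp; ring]
  exact mul_le_mul_of_nonneg_right h1 (by positivity)

/-- Large-`λ` algebra: with `t = (4 C₂ M / λ)²`, `(λ/2)⁻² · (d t) = 64 d C₂² M² λ⁻⁴`, in `ℝ≥0∞`.
[folklore] -/
theorem inv_half_sq_mul_sqrt_sq_eq {d C₂ M lam t : ℝ} (hd0 : 0 ≤ d) (hC₂0 : 0 < C₂) (hM : 0 < M)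
    (hlam : 0 < lam) (ht : t = (4 * C₂ * M / lam) ^ 2) :
    (ENNReal.ofReal (lam / 2))⁻¹ ^ 2 * ENNReal.ofReal (Real.sqrt (d * t)) ^ 2 =
      ENNReal.ofReal (64 * d * C₂ ^ 2 * M ^ 2) * ENNReal.ofReal (lam⁻¹ ^ 4) := by
  have ht0 : 0 < t := by rw [ht]; positivity
  rw [← ENNReal.ofReal_inv_of_pos (by positivity), ← ENNReal.ofReal_pow (by positivity),
    ← ENNReal.ofReal_pow (Real.sqrt_nonneg _), Real.sq_sqrt (by positivity),
    ← ENNReal.ofReal_mul (by positivity), ← ENNReal.ofReal_mul (by positivity)]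
  congr 1
  rw [ht]
  field_simp
  ring

/-- Constant bookkeeping `A₀ ≤ C₃ M² Q` for the weak-`L⁴` constant: with `T₁ = 128 d C₂² m²`,
`T₂ = 16 C₂²`, `64 d C₂² M² (m (a + b))² + 16 C₂² M² b² ≤ M² (T₁ + T₂) (a² + b²)`. [folklore] -/
theorem weakL4Const_le {d C₂ M m T₁ T₂ : ℝ} (hd0 : 0 ≤ d) (hm : 0 ≤ m)
    (hT₁ : T₁ = 128 * d * C₂ ^ 2 * m ^ 2) (hT₂ : T₂ = 16 * C₂ ^ 2) (a b : ℝ≥0∞) :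
    ENNReal.ofReal (64 * d * C₂ ^ 2 * M ^ 2) * (ENNReal.ofReal m * (a + b)) ^ 2 +
        ENNReal.ofReal (16 * C₂ ^ 2 * M ^ 2) * b ^ 2 ≤
      ENNReal.ofReal (M ^ 2) * ENNReal.ofReal (T₁ + T₂) * (a ^ 2 + b ^ 2) := by
  set Q : ℝ≥0∞ := a ^ 2 + b ^ 2 with hQ
  have hT₁0 : 0 ≤ T₁ := by rw [hT₁]; positivity
  have hT₂0 : 0 ≤ T₂ := by rw [hT₂]; positivity
  have hab2 : (a + b) ^ 2 ≤ 2 * Q := by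
    have h := ENNReal.rpow_add_le_mul_rpow_add_rpow a b (p := 2) one_le_two
    rw [show (2 : ℝ) - 1 = 1 by norm_num, ENNReal.rpow_one, ENNReal.rpow_two, ENNReal.rpow_two,
      ENNReal.rpow_two] at h
    rw [hQ]; exact h
  have hbQ : b ^ 2 ≤ Q := by rw [hQ]; exact le_add_self
  have e1 : ENNReal.ofReal (64 * d * C₂ ^ 2 * M ^ 2) * (ENNReal.ofReal m ^ 2 * (2 * Q)) =
      ENNReal.ofReal (M ^ 2 * T₁) * Q := by
    have h2 : (2 : ℝ≥0∞) = ENNReal.ofReal 2 := (ENNReal.ofReal_ofNat 2).symm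
    have hm2 : ENNReal.ofReal m ^ 2 = ENNReal.ofReal (m ^ 2) := (ENNReal.ofReal_pow hm 2).symm
    calc ENNReal.ofReal (64 * d * C₂ ^ 2 * M ^ 2) * (ENNReal.ofReal m ^ 2 * (2 * Q))
        = (ENNReal.ofReal (64 * d * C₂ ^ 2 * M ^ 2) * ENNReal.ofReal (m ^ 2) *
            ENNReal.ofReal 2) * Q := by rw [hm2, h2]; ring
      _ = ENNReal.ofReal (64 * d * C₂ ^ 2 * M ^ 2 * m ^ 2 * 2) * Q := by
          have hA0 : (0 : ℝ) ≤ 64 * d * C₂ ^ 2 * M ^ 2 :=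
            mul_nonneg (mul_nonneg (mul_nonneg (by norm_num) hd0) (sq_nonneg _)) (sq_nonneg _)
          have hAB0 : (0 : ℝ) ≤ 64 * d * C₂ ^ 2 * M ^ 2 * m ^ 2 := mul_nonneg hA0 (sq_nonneg _)
          rw [ENNReal.ofReal_mul hAB0, ENNReal.ofReal_mul hA0]
      _ = ENNReal.ofReal (M ^ 2 * T₁) * Q := by
          congr 2; rw [hT₁]; ring
  have e2 : ENNReal.ofReal (16 * C₂ ^ 2 * M ^ 2) * Q = ENNReal.ofReal (M ^ 2 * T₂) * Q := by
    rw [hT₂, show 16 * C₂ ^ 2 * M ^ 2 = M ^ 2 * (16 * C₂ ^ 2) by ring]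
  have e3 : ∀ X : ℝ≥0∞, ENNReal.ofReal (M ^ 2) * ENNReal.ofReal (T₁ + T₂) * X =
      ENNReal.ofReal (M ^ 2 * T₁) * X + ENNReal.ofReal (M ^ 2 * T₂) * X := by
    intro X
    rw [ENNReal.ofReal_add hT₁0 hT₂0, ENNReal.ofReal_mul (sq_nonneg M),
      ENNReal.ofReal_mul (sq_nonneg M)]
    ring
  calc ENNReal.ofReal (64 * d * C₂ ^ 2 * M ^ 2) * (ENNReal.ofReal m * (a + b)) ^ 2 +
        ENNReal.ofReal (16 * C₂ ^ 2 * M ^ 2) * b ^ 2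
      = ENNReal.ofReal (64 * d * C₂ ^ 2 * M ^ 2) * (ENNReal.ofReal m ^ 2 * (a + b) ^ 2) +
        ENNReal.ofReal (16 * C₂ ^ 2 * M ^ 2) * b ^ 2 := by rw [mul_pow]
    _ ≤ ENNReal.ofReal (64 * d * C₂ ^ 2 * M ^ 2) * (ENNReal.ofReal m ^ 2 * (2 * Q)) +
        ENNReal.ofReal (16 * C₂ ^ 2 * M ^ 2) * Q :=
        add_le_add (mul_le_mul_right (mul_le_mul_right hab2 _) _) (mul_le_mul_right hbQ _)
    _ = ENNReal.ofReal (M ^ 2) * ENNReal.ofReal (T₁ + T₂) * Q := by rw [e1, e2, e3 Q]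

/-- Exponent bookkeeping for the final assembly:
`3 · (2 (M² C₃ Q)^{3/4} V^{1/4}) = 6 C₃^{3/4} V^{1/4} M^{3/2} Q^{3/4}` (`0 ≤ M`). [folklore] -/
theorem three_mul_two_mul_rpow_eq {M C₃ : ℝ} (hM : 0 ≤ M) (Q V : ℝ≥0∞) :
    ENNReal.ofReal 3 * (2 * (ENNReal.ofReal (M ^ 2) * ENNReal.ofReal C₃ * Q) ^ (3 / 4 : ℝ) *
        V ^ (1 / 4 : ℝ)) =
      6 * ENNReal.ofReal C₃ ^ (3 / 4 : ℝ) * V ^ (1 / 4 : ℝ) * ENNReal.ofReal M ^ (3 / 2 : ℝ) *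
        Q ^ (3 / 4 : ℝ) := by
  have hM32 : ENNReal.ofReal (M ^ 2) ^ (3 / 4 : ℝ) = ENNReal.ofReal M ^ (3 / 2 : ℝ) := by
    rw [ENNReal.ofReal_pow hM, ← ENNReal.rpow_two, ← ENNReal.rpow_mul]
    norm_num
  rw [ENNReal.mul_rpow_of_nonneg _ _ (by norm_num), ENNReal.mul_rpow_of_nonneg _ _ (by norm_num),
    hM32, ENNReal.ofReal_ofNat]
  ring

/-- **The weak-`L⁴` step** (Seregin–Zhou 2020, Lemma 2.3 (2.2), heat-flow form): if `f = F` on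
`B(x₀, r)`, `‖e^{tΔ}F‖_∞ ≤ C₂ M t^{-1/2}` for `0 < t ≤ r²` and `‖F − e^{tΔ}F‖₂ ≤ √(d t) S'` for
`t > 0`, then for every `λ > 0`,
`|{‖f‖ > λ} ∩ B(x₀,r)| ≤ (64 d C₂² M² S'² + 16 C₂² M² r⁻² ‖f‖²_{L²(B(x₀,2r))}) λ⁻⁴`
(large `λ ≥ 4C₂M/r`: Chebyshev on `F − e^{tΔ}F` with `t = (4C₂M/λ)²`, where `‖e^{tΔ}F‖ ≤ λ/4`;
small `λ`: Chebyshev on `f`). [cite: SereginZhou2020, Lemma 2.3 (2.2), heat-flow substitute] -/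
theorem volume_inter_ball_lt_norm_le {f F : E → E} {x₀ : E} {r C₂ M d : ℝ} {S' : ℝ≥0∞}
    (hr : 0 < r) (hC₂0 : 0 < C₂) (hM : 0 < M) (hd0 : 0 ≤ d)
    (hf : AEStronglyMeasurable f volume) (hF2 : MemLp F 2 volume)
    (hFf : ∀ y ∈ ball x₀ r, f y = F y)
    (hheat : ∀ t : ℝ, 0 < t → t ≤ r ^ 2 → ∀ x, ‖heatExtension F t x‖ ≤ C₂ * M * t ^ (-(1 / 2 : ℝ)))
    (hdef : ∀ t : ℝ, 0 < t →
      eLpNorm (F - heatExtension F t) 2 volume ≤ ENNReal.ofReal (Real.sqrt (d * t)) * S')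
    {lam : ℝ} (hlam : 0 < lam) :
    volume ({y | lam < ‖f y‖} ∩ ball x₀ r) ≤
      (ENNReal.ofReal (64 * d * C₂ ^ 2 * M ^ 2) * S' ^ 2 +
          ENNReal.ofReal (16 * C₂ ^ 2 * M ^ 2) *
            ((ENNReal.ofReal r)⁻¹ * eLpNorm f 2 (volume.restrict (ball x₀ (2 * r)))) ^ 2) *
        (ENNReal.ofReal lam)⁻¹ ^ 4 := by
  set μ₂ := volume.restrict (ball x₀ (2 * r)) with hμ₂
  set b : ℝ≥0∞ := (ENNReal.ofReal r)⁻¹ * eLpNorm f 2 μ₂ with hb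
  set A₀ : ℝ≥0∞ := ENNReal.ofReal (64 * d * C₂ ^ 2 * M ^ 2) * S' ^ 2 +
    ENNReal.ofReal (16 * C₂ ^ 2 * M ^ 2) * b ^ 2 with hA₀
  have hlam4 : (ENNReal.ofReal lam)⁻¹ ^ 4 = ENNReal.ofReal (lam⁻¹ ^ 4) := by
    rw [ENNReal.ofReal_pow (inv_nonneg.2 hlam.le), ENNReal.ofReal_inv_of_pos hlam]
  by_cases hcase : 4 * C₂ * M / r ≤ lam
  · -- large `λ`: decompose `F = e^{tΔ}F + (F - e^{tΔ}F)` with `t = (4 C₂ M / λ)²`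
    set t : ℝ := (4 * C₂ * M / lam) ^ 2 with ht
    have h4 : 0 < 4 * C₂ * M := by positivity
    have ht0 : 0 < t := by rw [ht]; positivity
    have htr : t ≤ r ^ 2 := by
      rw [ht]
      refine pow_le_pow_left₀ (div_pos h4 hlam).le ?_ 2
      rw [div_le_iff₀ hlam]
      rw [div_le_iff₀ hr] at hcase
      linarith
    have hu2 : MemLp (heatExtension F t) 2 volume := memLp_heatExtension_holds hF2 (by norm_num) ht0
    have hvol := volume_inter_lt_norm_le_of_decomposition (f := f) (s := ball x₀ r) (F := F)
      (u := heatExtension F t) (h := F - heatExtension F t) hlam hFf (fun y => ?_)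
      (fun y => ?_) (hF2.1.sub hu2.1)
    rotate_left
    · simp
    · refine (hheat t ht0 htr y).trans (le_of_eq ?_)
      rw [ht, sq_rpow_neg_half h4 hlam]
      field_simp
    refine hvol.trans ?_
    -- `(λ/2)⁻² ‖F - e^{tΔ}F‖₂² ≤ (λ/2)⁻² d t S'² = 64 d C₂² M² λ⁻⁴ S'²`
    have hh2 : eLpNorm (F - heatExtension F t) 2 volume ^ (2 : ℝ) ≤
        (ENNReal.ofReal (Real.sqrt (d * t)) * S') ^ (2 : ℝ) :=
      ENNReal.rpow_le_rpow (hdef t ht0) (by norm_num)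
    refine (mul_le_mul_right hh2 _).trans ?_
    rw [ENNReal.rpow_two, ENNReal.rpow_two, mul_pow, ← mul_assoc, hlam4,
      inv_half_sq_mul_sqrt_sq_eq hd0 hC₂0 hM hlam ht]
    calc ENNReal.ofReal (64 * d * C₂ ^ 2 * M ^ 2) * ENNReal.ofReal (lam⁻¹ ^ 4) * S' ^ 2
        = ENNReal.ofReal (64 * d * C₂ ^ 2 * M ^ 2) * S' ^ 2 * ENNReal.ofReal (lam⁻¹ ^ 4) := by ring
      _ ≤ A₀ * ENNReal.ofReal (lam⁻¹ ^ 4) := by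
          rw [hA₀]; exact mul_le_mul_left le_self_add _
  · -- small `λ`: Chebyshev on `f`
    rw [not_le] at hcase
    have hvol := volume_inter_lt_norm_le measurableSet_ball hlam hf.restrict (s := ball x₀ r)
    refine hvol.trans ?_
    have hmono : eLpNorm f 2 (volume.restrict (ball x₀ r)) ≤ eLpNorm f 2 μ₂ :=
      eLpNorm_mono_measure f (Measure.restrict_mono (ball_subset_ball (by linarith)) le_rfl)
    rw [ENNReal.rpow_two, ENNReal.rpow_two, hlam4]
    calc (ENNReal.ofReal lam)⁻¹ ^ 2 * eLpNorm f 2 (volume.restrict (ball x₀ r)) ^ 2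
        ≤ (ENNReal.ofReal lam)⁻¹ ^ 2 * eLpNorm f 2 μ₂ ^ 2 := by gcongr
      _ = ENNReal.ofReal (lam⁻¹ ^ 2) * eLpNorm f 2 μ₂ ^ 2 := by
          rw [ENNReal.ofReal_pow (inv_nonneg.2 hlam.le), ENNReal.ofReal_inv_of_pos hlam]
      _ ≤ (ENNReal.ofReal (16 * C₂ ^ 2 * M ^ 2) * (ENNReal.ofReal r)⁻¹ ^ 2 * ENNReal.ofReal (lam⁻¹ ^ 4)) *
            eLpNorm f 2 μ₂ ^ 2 := by
          refine mul_le_mul_left ?_ _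
          rw [← ENNReal.ofReal_inv_of_pos hr, ← ENNReal.ofReal_pow (inv_nonneg.2 hr.le),
            ← ENNReal.ofReal_mul (by positivity), ← ENNReal.ofReal_mul (by positivity)]
          exact ENNReal.ofReal_le_ofReal (inv_sq_le_const_mul_inv_pow_four hr hlam hcase)
      _ = ENNReal.ofReal (16 * C₂ ^ 2 * M ^ 2) * b ^ 2 * ENNReal.ofReal (lam⁻¹ ^ 4) := by
          rw [hb, mul_pow]; ring
      _ ≤ A₀ * ENNReal.ofReal (lam⁻¹ ^ 4) := by
          rw [hA₀]; exact mul_le_mul_left le_add_self _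

/-- **The local `L³` bound for `Ḃ^{-1}_{∞,∞}`-bounded fields** (Seregin–Zhou 2020, Lemma 2.3
with the Hölder step of Lemma 2.4, in the tree's heat-flow form). There is `C`, depending only
on `E`, such that: if `f : E → E` is a.e. strongly measurable, integrable against centred
Gaussians, with `‖e^{sΔ}f(y)‖ ≤ M s^{-1/2}` (`M > 0`), and has a weak derivative `g` on
`B(x₀, 2r)` with `f ∈ L²(B(x₀,2r))`, then
`∫_{B(x₀,r)} ‖f‖³ ≤ C |B(x₀,r)|^{1/4} M^{3/2} (‖g‖²_{L²(B(x₀,2r))} + r⁻²‖f‖²_{L²(B(x₀,2r))})^{3/4}`.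
[cite: SereginZhou2020, Lemma 2.3 (2.3) and Lemma 2.4 (Hölder step), heat-flow substitute] -/
theorem exists_lintegral_ball_enorm_pow_three_le :
    ∃ C : ℝ≥0, ∀ (f : E → E) (g : E → E →L[ℝ] E) (M : ℝ) (x₀ : E) (r : ℝ), 0 < M → 0 < r →
      AEStronglyMeasurable f volume →
      (∀ a : ℝ, 0 < a → Integrable (fun y => heatKernel a y * ‖f y‖) volume) →
      (∀ s : ℝ, 0 < s → ∀ y, ‖heatExtension f s y‖ ≤ M * s ^ (-(1 / 2 : ℝ))) →
      FunctionSpaces.HasWeakFDerivOn (⟨ball x₀ (2 * r), isOpen_ball⟩ : TopologicalSpace.Opens E)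
        volume f g →
      MemLp f 2 (volume.restrict (ball x₀ (2 * r))) →
      ∫⁻ y in ball x₀ r, ‖f y‖ₑ ^ (3 : ℕ) ≤
        C * volume (ball x₀ r) ^ (1 / 4 : ℝ) * ENNReal.ofReal M ^ (3 / 2 : ℝ) *
          (eLpNorm g 2 (volume.restrict (ball x₀ (2 * r))) ^ 2 +
            (ENNReal.ofReal r)⁻¹ ^ 2 * eLpNorm f 2 (volume.restrict (ball x₀ (2 * r))) ^ 2) ^
              (3 / 4 : ℝ) := by
  haveI : CompleteSpace E := FiniteDimensional.complete ℝ E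
  obtain ⟨c₁, c₂, hc₁, hc₂, hcut⟩ := exists_cutoff (E := E)
  -- constants depending only on `E`
  set d : ℝ := (Module.finrank ℝ E : ℝ) with hd
  set A₁ : ℝ := ∫ y, ‖iteratedFDeriv ℝ 1 (heatKernel (E := E) 1) y‖ with hA₁
  set A₂ : ℝ := ∫ y, ‖iteratedFDeriv ℝ 2 (heatKernel (E := E) 1) y‖ with hA₂
  set C₂ : ℝ := 1 + 2 * (d * (c₂ + 2 * c₁ * A₁ + A₂)) with hC₂
  have hd0 : 0 ≤ d := by rw [hd]; positivity
  have hA₁0 : 0 ≤ A₁ := integral_nonneg fun _ => norm_nonneg _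
  have hA₂0 : 0 ≤ A₂ := integral_nonneg fun _ => norm_nonneg _
  have hC₂1 : 1 ≤ C₂ := by
    rw [hC₂]
    have : 0 ≤ d * (c₂ + 2 * c₁ * A₁ + A₂) := by positivity
    linarith
  have hC₂0 : 0 < C₂ := by linarith
  set C₃ : ℝ := 128 * d * C₂ ^ 2 * (max 1 c₁) ^ 2 + 16 * C₂ ^ 2 with hC₃
  have hC₃0 : 0 ≤ C₃ := by rw [hC₃]; positivity
  refine ⟨(6 * C₃ ^ (3 / 4 : ℝ)).toNNReal, fun f g M x₀ r hM hr hf hG hMb hw hf2 => ?_⟩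
  set μ₂ := volume.restrict (ball x₀ (2 * r)) with hμ₂
  set μ₁ := volume.restrict (ball x₀ r) with hμ₁
  set a : ℝ≥0∞ := eLpNorm g 2 μ₂ with ha
  set b : ℝ≥0∞ := (ENNReal.ofReal r)⁻¹ * eLpNorm f 2 μ₂ with hb
  set Q : ℝ≥0∞ := a ^ 2 + b ^ 2 with hQ
  set V : ℝ≥0∞ := volume (ball x₀ r) with hV
  have hQ' : eLpNorm g 2 μ₂ ^ 2 + (ENNReal.ofReal r)⁻¹ ^ 2 * eLpNorm f 2 μ₂ ^ 2 = Q := by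
    rw [hQ, hb, mul_pow]
  rw [hQ']
  have hCcoe : (((6 * C₃ ^ (3 / 4 : ℝ)).toNNReal : ℝ≥0) : ℝ≥0∞) = 6 * ENNReal.ofReal C₃ ^ (3 / 4 : ℝ) := by
    rw [← ENNReal.ofReal.eq_1, ENNReal.ofReal_mul (by norm_num), ENNReal.ofReal_rpow_of_nonneg hC₃0
      (by norm_num)]
    norm_num
  rw [hCcoe]
  -- positivity facts
  have hV0 : V ≠ 0 := (measure_ball_pos volume x₀ hr).ne'
  have hVtop : V ≠ ⊤ := measure_ball_lt_top.ne
  have hM0e : ENNReal.ofReal M ≠ 0 := by simpa using hM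
  have hC₃pos : 0 < C₃ := by
    rw [hC₃]
    have : 0 ≤ 128 * d * C₂ ^ 2 * (max 1 c₁) ^ 2 := by positivity
    nlinarith
  have hpre : 6 * ENNReal.ofReal C₃ ^ (3 / 4 : ℝ) * V ^ (1 / 4 : ℝ) * ENNReal.ofReal M ^ (3 / 2 : ℝ) ≠ 0 := by
    refine mul_ne_zero (mul_ne_zero (mul_ne_zero (by norm_num) ?_) ?_) ?_
    · exact (ENNReal.rpow_pos (by simpa using hC₃pos) ENNReal.ofReal_ne_top).ne'
    · exact (ENNReal.rpow_pos (pos_iff_ne_zero.2 hV0) hVtop).ne'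
    · exact (ENNReal.rpow_pos (pos_iff_ne_zero.2 hM0e) ENNReal.ofReal_ne_top).ne'
  -- trivial if `g ∉ L²`
  have hgm : AEStronglyMeasurable g μ₂ := hw.locallyIntegrableOn_deriv.aestronglyMeasurable
  by_cases hgtop : eLpNorm g 2 μ₂ = ⊤
  · have hQtop : Q = ⊤ := by rw [hQ, ha, hgtop, ENNReal.top_pow two_ne_zero]; exact top_add _
    rw [hQtop, ENNReal.top_rpow_of_pos (by norm_num), ENNReal.mul_top hpre]
    exact le_top
  have hg2 : MemLp g 2 μ₂ := ⟨hgm, lt_top_iff_ne_top.2 hgtop⟩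
  have hatop : a ≠ ⊤ := hgtop
  have hbtop : b ≠ ⊤ := ENNReal.mul_ne_top (ENNReal.inv_ne_top.2 (by simpa using hr)) hf2.eLpNorm_ne_top
  -- the cut-off and the cut-off field
  obtain ⟨φ, hφ, hφc, hφsupp, hφone, hφ0, hφle1, hD1, hD2⟩ := hcut x₀ r hr
  have hφ2 : ContDiff ℝ 2 φ := contDiff_infty.1 hφ 2
  have hφ1 : ContDiff ℝ 1 φ := contDiff_infty.1 hφ 1
  have habs : ∀ y, |φ y| ≤ 1 := fun y => abs_le.2 ⟨by linarith [hφ0 y], hφle1 y⟩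
  have hD1' : ∀ y, ‖fderiv ℝ φ y‖ ≤ c₁ / r := fun y => by rw [← norm_iteratedFDeriv_one]; exact hD1 y
  set F : E → E := fun y => φ y • f y with hF
  set gF : E → E →L[ℝ] E := fun y => φ y • g y + (fderiv ℝ φ y).smulRight (f y) with hgF
  have hF2 : MemLp F 2 volume :=
    memLp_smul_of_tsupport_subset (Ω := ⟨ball x₀ (2 * r), isOpen_ball⟩) hf2 hφ.continuous hφc hφsupp
  have hFf : ∀ y ∈ ball x₀ r, f y = F y := fun y hy => by
    rw [hF]; dsimp only
    rw [hφone y (ball_subset_closedBall hy), one_smul]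
  -- (i) heat-flow bound on `e^{tΔ}F`
  have hheat : ∀ t : ℝ, 0 < t → t ≤ r ^ 2 → ∀ x, ‖heatExtension F t x‖ ≤ C₂ * M * t ^ (-(1 / 2 : ℝ)) :=
    fun t ht htr x =>
      HeatBesovPairing.norm_heatExtension_cutoff_smul_le hf hG hMb hφ2 hφc hc₁ hc₂ hr habs hD1 hD2
        ht htr x
  -- (ii) the `L²` defect of the heat flow on `F`
  have hdef : ∀ t : ℝ, 0 < t → eLpNorm (F - heatExtension F t) 2 volume ≤
      ENNReal.ofReal (Real.sqrt (d * t)) * eLpNorm gF 2 volume := fun t ht =>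
    eLpNorm_smul_sub_heatExtension_smul_le (Ω := ⟨ball x₀ (2 * r), isOpen_ball⟩) hw hf2 hg2 hφ hφc
      hφsupp ht
  -- (iii) the size of `∇F`
  set S' : ℝ≥0∞ := ENNReal.ofReal (max 1 c₁) * (a + b) with hS'
  have hS : eLpNorm gF 2 volume ≤ S' := by
    have h1 := eLpNorm_cutoff_gradient_le hφ1 hφsupp habs hD1' hf2.1 hgm
    rw [← hμ₂] at h1
    refine h1.trans ?_
    rw [hS', ← ha, ENNReal.ofReal_div_of_pos hr, div_eq_mul_inv, mul_assoc, ← hb, mul_add]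
    have hmax : (1 : ℝ≥0∞) ≤ ENNReal.ofReal (max 1 c₁) := by
      rw [← ENNReal.ofReal_one]; exact ENNReal.ofReal_le_ofReal (le_max_left _ _)
    exact add_le_add (le_mul_of_one_le_left zero_le hmax)
      (mul_le_mul_left (ENNReal.ofReal_le_ofReal (le_max_right _ _)) _)
  -- (iv) the weak-`L⁴` bound: `μ₁ {‖f‖ > λ} ≤ A₀ λ⁻⁴` (`volume_inter_ball_lt_norm_le`)
  set A₀ : ℝ≥0∞ := ENNReal.ofReal (64 * d * C₂ ^ 2 * M ^ 2) * S' ^ 2 +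
    ENNReal.ofReal (16 * C₂ ^ 2 * M ^ 2) * b ^ 2 with hA₀
  have hdist : ∀ lam : ℝ, 0 < lam → μ₁ {y | lam < ‖f y‖} ≤ A₀ * (ENNReal.ofReal lam)⁻¹ ^ 4 := by
    intro lam hlam
    rw [hμ₁, Measure.restrict_apply' measurableSet_ball]
    exact volume_inter_ball_lt_norm_le hr hC₂0 hM hd0 hf hF2 hFf hheat
      (fun t ht => (hdef t ht).trans (mul_le_mul_right hS _)) hlam
  -- (v) layer cake on `B(x₀, r)`
  have hLC : ∫⁻ y in ball x₀ r, ‖f y‖ₑ ^ (3 : ℕ) =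
      ENNReal.ofReal 3 * ∫⁻ t in Ioi 0, μ₁ {y | t < ‖f y‖} * ENNReal.ofReal (t ^ (2 : ℝ)) := by
    have h := lintegral_rpow_eq_lintegral_meas_lt_mul μ₁ (f := fun y => ‖f y‖)
      (Eventually.of_forall fun y => norm_nonneg _) hf.restrict.norm.aemeasurable (p := 3) (by norm_num)
    rw [show (3 : ℝ) - 1 = 2 by norm_num] at h
    rw [← h, hμ₁]
    refine lintegral_congr fun y => ?_
    rw [show (3 : ℝ) = ((3 : ℕ) : ℝ) by norm_num, Real.rpow_natCast, ENNReal.ofReal_pow (norm_nonneg _),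
      ofReal_norm]
  have hLC2 : ∫⁻ t in Ioi 0, μ₁ {y | t < ‖f y‖} * ENNReal.ofReal (t ^ (2 : ℝ)) ≤
      2 * A₀ ^ (3 / 4 : ℝ) * V ^ (1 / 4 : ℝ) := by
    refine (setLIntegral_mono' measurableSet_Ioi fun t ht => ?_).trans (lintegral_Ioi_min_mul_sq_le V A₀)
    rw [Real.rpow_two]
    refine mul_le_mul_left (le_min ?_ (hdist t ht)) _
    rw [hV, hμ₁, ← Measure.restrict_apply_univ (μ := volume) (s := ball x₀ r)]
    exact measure_mono (subset_univ _)
  -- (vi) `A₀ ≤ C₃ M² Q` (`weakL4Const_le`)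
  have hA₀le : A₀ ≤ ENNReal.ofReal (M ^ 2) * ENNReal.ofReal C₃ * Q := by
    rw [hA₀, hS', hQ, hC₃]
    exact weakL4Const_le (M := M) hd0 (zero_le_one.trans (le_max_left 1 c₁)) rfl rfl a b
  -- (vii) assemble (`three_mul_two_mul_rpow_eq`)
  calc ∫⁻ y in ball x₀ r, ‖f y‖ₑ ^ (3 : ℕ)
      = ENNReal.ofReal 3 * ∫⁻ t in Ioi 0, μ₁ {y | t < ‖f y‖} * ENNReal.ofReal (t ^ (2 : ℝ)) := hLC
    _ ≤ ENNReal.ofReal 3 * (2 * A₀ ^ (3 / 4 : ℝ) * V ^ (1 / 4 : ℝ)) := mul_le_mul_right hLC2 _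
    _ ≤ ENNReal.ofReal 3 * (2 * (ENNReal.ofReal (M ^ 2) * ENNReal.ofReal C₃ * Q) ^ (3 / 4 : ℝ) *
          V ^ (1 / 4 : ℝ)) :=
        mul_le_mul_right (mul_le_mul_left (mul_le_mul_right
          (ENNReal.rpow_le_rpow hA₀le (by norm_num)) 2) _) _
    _ = 6 * ENNReal.ofReal C₃ ^ (3 / 4 : ℝ) * V ^ (1 / 4 : ℝ) * ENNReal.ofReal M ^ (3 / 2 : ℝ) *
          Q ^ (3 / 4 : ℝ) := three_mul_two_mul_rpow_eq hM.le Q V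

end SereginZhouWeakL4

end Literature.Analysis.FluidPDE
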